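import Mathlib
import Summits.ValiantsHypothesis.ValiantsHypothesis.Theorems.BarrierLeverPartitionMinorsHitByVPHiddenStatesBallCutPrep

/-!
# Route BarrierLever — item `PartitionMinorsHitByVP` (stmt-ValiantsHypothesis-19717), line `hidden-states`:
# THE EXACT COORDINATE CUT FOR THE BALL DESIGN, II — balanced coordinates: `S_m ⇐ S_k ∧ S_{m-k}` one level down

Helper file (`--supports stmt-ValiantsHypothesis-19717`; cell valiant-natproofs, 𝒟-side door (c), registered line
`Cruxes/PartitionMinorsHitByVP/Lines/hidden_states.lean` v9; prover seat val-np-p6 gen 21).  Closes NO item; definition-free.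

THE POINT (memo HOME/val-np-p6/g21/MEMO-valnp6-g21.md §1–§2).  A coordinate `x` of an m-swap family `𝒰 = B_{t+1}(S) ∖ {A_l} ∪ {C_l}`
(`|A_l| = t + 1`, `|C_l| = t + 2`) is BALANCED when as many `A_l` as `C_l` contain it: `#{l : x ∈ A_l} = #{l : x ∈ C_l} = k`.  Cutting at a
balanced coordinate (the table reads `x` through the state `x` only) is EXACT: the rows avoiding `x` against the columns avoiding `x` are
the `(m-k)`-swap family `B_{t+1}(S ∖ x) ∖ {A_l : x ∉ A_l} ∪ {C_l : x ∉ C_l}` (the DELETION), and the rows through `x`, `x` erased, against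
the columns through `x`, `x` erased, are the `k`-swap family `B_t(S ∖ x) ∖ {A_l ∖ x : x ∈ A_l} ∪ {C_l ∖ x : x ∈ C_l}` (the LINK) — both
blocks square exactly because `x` is balanced (`card_shellFamily_filter`).  Hence
* ★ `served_of_erase_balanced` — LINK served ∧ DELETION served ⇒ the family is served (every bijective enumeration generically good);
  `symGood_insert_state` is the bookkeeping «a state read by no coordinate can be added to every column».
With the landed first and second shells (`SecondShell.exists_table_firstShell_anyH`, `SecondShell.exists_table_secondShell`) this
serves outright every THIRD-shell family having a balanced coordinate with `k ∈ {1, 2}` (sibling `…BallCutThirdShell`); census (kit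
j327904/5/6, val-np-p6 g21): that is 86.9 % of third-shell families at `(t, h) = (3, 7)`, 91.1 % at `(3, 8)`, 93.6 % at `(4, 9)`, and
together with g20's triangular path-table certificates 100 % of every sample at `t ≥ 3` (4 000 / 2 000 / 1 500 families, 0 uncovered).

HONEST LABEL: conjecture-column toolkit (m-th shell of the ball, every `m, t, h`); 19717 stays OPEN; nothing on crux 14610 or VP ≠ VNP.
-/

set_option linter.dupNamespace false

namespace Summit.ValiantsHypothesis.ValiantsHypothesis.Theorems.BarrierLever.HiddenStates

open Finset

noncomputable section

namespace BallCut

open SymbJoin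

variable {h : ℕ}

/-! ## 1. Bookkeeping -/

/-- Adding to every column a state that no coordinate reads preserves generic goodness. -/
theorem symGood_insert_state {r₁ : ℕ} (x : Fin h) (v c : Fin r₁ → Finset (Fin h)) (hx : ∀ j, x ∈ c j)
    (H : symDet v (fun j => ((0 : Fin 1), (c j).erase x)) ≠ 0) :
    symDet v (fun j => ((0 : Fin 1), c j)) ≠ 0 := by
  classical
  rw [← exists_table_iff_symGood] at H ⊢
  obtain ⟨tx, htx⟩ := H
  let tx' : Option (Fin h) → Fin h → ℂ := fun o a =>
    match o with
    | none => tx none a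
    | some q => if q = x then 0 else tx (some q) a
  refine ⟨tx', ?_⟩
  have hpt : ∀ j a, tx' none a + ∑ q ∈ c j, tx' (some q) a = tx none a + ∑ q ∈ (c j).erase x, tx (some q) a := by
    intro j a
    simp only [tx']
    rw [← Finset.add_sum_erase (c j) _ (hx j), if_pos rfl, zero_add]
    congr 1
    exact Finset.sum_congr rfl fun q hq => by rw [if_neg (Finset.ne_of_mem_erase hq)]
  have hM : (Matrix.of fun i j : Fin r₁ => ∏ a ∈ v i, (tx' none a + ∑ q ∈ c j, tx' (some q) a))
      = Matrix.of fun i j : Fin r₁ => ∏ a ∈ v i, (tx none a + ∑ q ∈ (c j).erase x, tx (some q) a) := by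
    ext i j
    simp only [Matrix.of_apply]
    exact Finset.prod_congr rfl fun a _ => hpt j a
  rw [hM]; exact htx

/-- `|B ∖ A(I) ∪ C(I')| = |B|` for index sets `I, I'` of equal size (`A` injective into `B`, `C` injective outside `B`). -/
theorem card_shellFamily_filter (t : ℕ) {m : ℕ} (S : Finset (Fin h)) (A C : Fin m → Finset (Fin h))
    (hA : ∀ l, (A l).card = t) (hC : ∀ l, (C l).card = t + 1)
    (hAi : Function.Injective A) (hCi : Function.Injective C)
    (I I' : Finset (Fin m)) (hAS : ∀ l, l ∈ I → A l ⊆ S) (hII' : I.card = I'.card) :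
    (((S.powerset.filter fun J => J.card ≤ t) \ I.image A) ∪ I'.image C).card
      = (S.powerset.filter fun J => J.card ≤ t).card := by
  classical
  set B := S.powerset.filter fun J => J.card ≤ t with hB
  have hAB : I.image A ⊆ B := by
    intro U hU
    obtain ⟨l, hl, rfl⟩ := Finset.mem_image.1 hU
    rw [hB, Finset.mem_filter, Finset.mem_powerset]
    exact ⟨hAS l hl, (hA l).le⟩
  have hdisj : Disjoint (B \ I.image A) (I'.image C) := by
    rw [Finset.disjoint_left]
    intro U hU hU'
    obtain ⟨l, -, rfl⟩ := Finset.mem_image.1 hU'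
    have := (Finset.mem_filter.1 (Finset.mem_sdiff.1 hU).1).2
    rw [hC l] at this
    omega
  rw [Finset.card_union_of_disjoint hdisj, Finset.card_sdiff_of_subset hAB,
    Finset.card_image_of_injective _ hAi, Finset.card_image_of_injective _ hCi]
  have : I.card ≤ B.card := by
    have := Finset.card_le_card hAB
    rwa [Finset.card_image_of_injective _ hAi] at this
  omega

/-! ## 2. The cut at a balanced coordinate -/

/-- ★ **THE BALANCED-COORDINATE CUT.**  `x` is balanced for the m-swap family of `(A, C)` at level `t + 1` on `S`
(`#{l : x ∈ A_l} = #{l : x ∈ C_l}`).  If the LINK family (level `t`, the swaps through `x` with `x` erased) and the DELETION family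
(level `t + 1`, the swaps avoiding `x`) are served on `S.erase x` (every bijective enumeration generically good), then so is the family
on `S`. -/
theorem served_of_erase_balanced (t : ℕ) {m : ℕ} (A C : Fin m → Finset (Fin h))
    (hA : ∀ l, (A l).card = t + 1) (hC : ∀ l, (C l).card = t + 2)
    (hAi : Function.Injective A) (hCi : Function.Injective C)
    (S : Finset (Fin h)) (x : Fin h) (hxS : x ∈ S) (hAS : ∀ l, A l ⊆ S)
    (hbal : (Finset.univ.filter fun l => x ∈ A l).card = (Finset.univ.filter fun l => x ∈ C l).card)
    (Hlink : ∀ ⦃r : ℕ⦄ (u cols : Fin r → Finset (Fin h)), Function.Injective u → Function.Injective cols →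
      (∀ U, (∃ i, u i = U) ↔ ((U ⊆ S.erase x ∧ U.card ≤ t ∧ ∀ l, x ∈ A l → U ≠ (A l).erase x) ∨
        ∃ l, x ∈ C l ∧ U = (C l).erase x)) →
      (∀ J, (∃ k, cols k = J) ↔ (J ⊆ S.erase x ∧ J.card ≤ t)) →
      symDet u (fun k => ((0 : Fin 1), cols k)) ≠ 0)
    (Hdel : ∀ ⦃r : ℕ⦄ (u cols : Fin r → Finset (Fin h)), Function.Injective u → Function.Injective cols →
      (∀ U, (∃ i, u i = U) ↔ ((U ⊆ S.erase x ∧ U.card ≤ t + 1 ∧ ∀ l, x ∉ A l → U ≠ A l) ∨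
        ∃ l, x ∉ C l ∧ U = C l)) →
      (∀ J, (∃ k, cols k = J) ↔ (J ⊆ S.erase x ∧ J.card ≤ t + 1)) →
      symDet u (fun k => ((0 : Fin 1), cols k)) ≠ 0)
    {r : ℕ} (u cols : Fin r → Finset (Fin h)) (hu : Function.Injective u) (hcinj : Function.Injective cols)
    (hU : ∀ U, (∃ i, u i = U) ↔ ((U ⊆ S ∧ U.card ≤ t + 1 ∧ ∀ l, U ≠ A l) ∨ ∃ l, U = C l))
    (hJ : ∀ J, (∃ k, cols k = J) ↔ (J ⊆ S ∧ J.card ≤ t + 1)) :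
    symDet u (fun k => ((0 : Fin 1), cols k)) ≠ 0 := by
  classical
  -- the four index classes
  set R₀ := Finset.univ.filter fun i : Fin r => x ∉ u i with hR₀
  set R₁ := Finset.univ.filter fun i : Fin r => ¬ (x ∉ u i) with hR₁
  set K₀ := Finset.univ.filter fun k : Fin r => x ∉ cols k with hK₀
  set K₁ := Finset.univ.filter fun k : Fin r => ¬ (x ∉ cols k) with hK₁
  have hr : R₀.card + R₁.card = r := by
    rw [hR₀, hR₁, Finset.card_filter_add_card_filter_not, Finset.card_univ, Fintype.card_fin]
  have hrK : K₀.card + K₁.card = r := by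
    rw [hK₀, hK₁, Finset.card_filter_add_card_filter_not, Finset.card_univ, Fintype.card_fin]
  -- the deletion family and the ball one coordinate down
  set IA := Finset.univ.filter fun l : Fin m => x ∉ A l with hIA
  set IC := Finset.univ.filter fun l : Fin m => x ∉ C l with hIC
  have hIAC : IA.card = IC.card := by
    have h1 := Finset.card_filter_add_card_filter_not (s := (Finset.univ : Finset (Fin m))) (fun l => x ∈ A l)
    have h2 := Finset.card_filter_add_card_filter_not (s := (Finset.univ : Finset (Fin m))) (fun l => x ∈ C l)
    rw [hIA, hIC]; omega
  set B' := (S.erase x).powerset.filter fun J => J.card ≤ t + 1 with hB'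
  set 𝒰' := (B' \ IA.image A) ∪ IC.image C with h𝒰'
  have hmemB' : ∀ J, J ∈ B' ↔ J ⊆ S.erase x ∧ J.card ≤ t + 1 := fun J => by simp [hB']
  have hmem𝒰' : ∀ U, U ∈ 𝒰' ↔ ((U ⊆ S.erase x ∧ U.card ≤ t + 1 ∧ ∀ l, x ∉ A l → U ≠ A l) ∨
      ∃ l, x ∉ C l ∧ U = C l) := by
    intro U
    rw [h𝒰', Finset.mem_union, Finset.mem_sdiff, hmemB']
    simp only [Finset.mem_image, hIA, hIC, Finset.mem_filter, Finset.mem_univ, true_and, not_exists, not_and,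
      and_assoc]
    constructor
    · rintro (⟨h1, h2, h3⟩ | ⟨l, hl, hl'⟩)
      · exact Or.inl ⟨h1, h2, fun l hl hU' => h3 l hl hU'.symm⟩
      · exact Or.inr ⟨l, hl, hl'.symm⟩
    · rintro (⟨h1, h2, h3⟩ | ⟨l, hl, hl'⟩)
      · exact Or.inl ⟨h1, h2, fun l hl hU' => h3 l hl hU'.symm⟩
      · exact Or.inr ⟨l, hl, hl'.symm⟩
  have hrow_avoid : ∀ U, (∃ i, u i = U ∧ x ∉ u i) ↔ U ∈ 𝒰' := by
    intro U
    rw [hmem𝒰']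
    constructor
    · rintro ⟨i, rfl, hxi⟩
      rcases (hU (u i)).1 ⟨i, rfl⟩ with ⟨h1, h2, h3⟩ | ⟨l, hl⟩
      · exact Or.inl ⟨fun a ha => Finset.mem_erase.2 ⟨fun hax => hxi (hax ▸ ha), h1 ha⟩, h2, fun l _ => h3 l⟩
      · exact Or.inr ⟨l, fun hx => hxi (hl ▸ hx), hl⟩
    · rintro (⟨h1, h2, h3⟩ | ⟨l, hxl, rfl⟩)
      · have hxU : x ∉ U := fun hx => Finset.notMem_erase x S (h1 hx)
        obtain ⟨i, hi⟩ := (hU U).2 (Or.inl ⟨fun a ha => Finset.mem_of_mem_erase (h1 ha), h2,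
          fun l hUl => (em (x ∈ A l)).elim (fun hx => hxU (hUl ▸ hx)) (fun hx => h3 l hx hUl)⟩)
        exact ⟨i, hi, fun hx => hxU (hi ▸ hx)⟩
      · obtain ⟨i, hi⟩ := (hU (C l)).2 (Or.inr ⟨l, rfl⟩)
        exact ⟨i, hi, fun hx => hxl (hi ▸ hx)⟩
  have hcol_avoid : ∀ J, (∃ k, cols k = J ∧ x ∉ cols k) ↔ J ∈ B' := by
    intro J
    rw [hmemB']
    constructor
    · rintro ⟨k, rfl, hxk⟩
      obtain ⟨h1, h2⟩ := (hJ (cols k)).1 ⟨k, rfl⟩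
      exact ⟨fun a ha => Finset.mem_erase.2 ⟨fun hax => hxk (hax ▸ ha), h1 ha⟩, h2⟩
    · rintro ⟨h1, h2⟩
      obtain ⟨k, hk⟩ := (hJ J).2 ⟨fun a ha => Finset.mem_of_mem_erase (h1 ha), h2⟩
      exact ⟨k, hk, fun hx => Finset.notMem_erase x S (h1 (hk ▸ hx))⟩
  have hR₀img : R₀.image u = 𝒰' := by
    ext U
    rw [Finset.mem_image, ← hrow_avoid]
    simp [hR₀]
    constructor
    · rintro ⟨i, hxi, rfl⟩; exact ⟨i, rfl, hxi⟩
    · rintro ⟨i, rfl, hxi⟩; exact ⟨i, hxi, rfl⟩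
  have hK₀img : K₀.image cols = B' := by
    ext J
    rw [Finset.mem_image, ← hcol_avoid]
    simp [hK₀]
    constructor
    · rintro ⟨k, hxk, rfl⟩; exact ⟨k, rfl, hxk⟩
    · rintro ⟨k, rfl, hxk⟩; exact ⟨k, hxk, rfl⟩
  have hcount : K₀.card = R₀.card := by
    rw [← Finset.card_image_of_injective K₀ hcinj, ← Finset.card_image_of_injective R₀ hu, hR₀img, hK₀img, h𝒰', hB']
    refine (card_shellFamily_filter (t + 1) (S.erase x) A C hA hC hAi hCi IA IC (fun l hl => ?_) hIAC).symm
    have hxl : x ∉ A l := (Finset.mem_filter.1 hl).2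
    exact fun a ha => Finset.mem_erase.2 ⟨fun hax => hxl (hax ▸ ha), hAS l ha⟩
  have hcount₁ : K₁.card = R₁.card := by omega
  -- the enumerations
  let f₀ : Fin R₀.card ↪o Fin r := R₀.orderEmbOfFin rfl
  let f₁ : Fin R₁.card ↪o Fin r := R₁.orderEmbOfFin rfl
  let g₀ : Fin R₀.card ↪o Fin r := K₀.orderEmbOfFin hcount
  let g₁ : Fin R₁.card ↪o Fin r := K₁.orderEmbOfFin hcount₁
  have hf₀ : ∀ j, x ∉ u (f₀ j) := fun j => by
    have hm : f₀ j ∈ Finset.univ.filter (fun i : Fin r => x ∉ u i) := Finset.orderEmbOfFin_mem R₀ rfl j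
    exact (Finset.mem_filter.1 hm).2
  have hf₁ : ∀ j, x ∈ u (f₁ j) := fun j => by
    have hm : f₁ j ∈ Finset.univ.filter (fun i : Fin r => ¬ (x ∉ u i)) := Finset.orderEmbOfFin_mem R₁ rfl j
    exact not_not.1 (Finset.mem_filter.1 hm).2
  have hg₀ : ∀ j, x ∉ cols (g₀ j) := fun j => by
    have hm : g₀ j ∈ Finset.univ.filter (fun k : Fin r => x ∉ cols k) := Finset.orderEmbOfFin_mem K₀ hcount j
    exact (Finset.mem_filter.1 hm).2
  have hg₁ : ∀ j, x ∈ cols (g₁ j) := fun j => by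
    have hm : g₁ j ∈ Finset.univ.filter (fun k : Fin r => ¬ (x ∉ cols k)) := Finset.orderEmbOfFin_mem K₁ hcount₁ j
    exact not_not.1 (Finset.mem_filter.1 hm).2
  have hf₀sur : ∀ i, x ∉ u i → ∃ j, f₀ j = i := fun i hi => by
    have : i ∈ Set.range f₀ := by
      rw [show Set.range f₀ = ↑R₀ from Finset.range_orderEmbOfFin R₀ rfl]; simp [hR₀, hi]
    exact this
  have hf₁sur : ∀ i, x ∈ u i → ∃ j, f₁ j = i := fun i hi => by
    have : i ∈ Set.range f₁ := by
      rw [show Set.range f₁ = ↑R₁ from Finset.range_orderEmbOfFin R₁ rfl]; simp [hR₁, hi]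
    exact this
  have hg₀sur : ∀ k, x ∉ cols k → ∃ j, g₀ j = k := fun k hk => by
    have : k ∈ Set.range g₀ := by
      rw [show Set.range g₀ = ↑K₀ from Finset.range_orderEmbOfFin K₀ hcount]; simp [hK₀, hk]
    exact this
  have hg₁sur : ∀ k, x ∈ cols k → ∃ j, g₁ j = k := fun k hk => by
    have : k ∈ Set.range g₁ := by
      rw [show Set.range g₁ = ↑K₁ from Finset.range_orderEmbOfFin K₁ hcount₁]; simp [hK₁, hk]
    exact this
  have hf : Function.Injective (Sum.elim (fun j => f₀ j) (fun j => f₁ j)) := by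
    rintro (j | j) (j' | j') hjj'
    · simp only [Sum.elim_inl] at hjj'; rw [f₀.injective hjj']
    · simp only [Sum.elim_inl, Sum.elim_inr] at hjj'; exact absurd (hjj' ▸ hf₁ j') (hf₀ j)
    · simp only [Sum.elim_inl, Sum.elim_inr] at hjj'; exact absurd (hjj' ▸ hf₁ j) (hf₀ j')
    · simp only [Sum.elim_inr] at hjj'; rw [f₁.injective hjj']
  have hg : Function.Injective (Sum.elim (fun j => g₀ j) (fun j => g₁ j)) := by
    rintro (j | j) (j' | j') hjj'
    · simp only [Sum.elim_inl] at hjj'; rw [g₀.injective hjj']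
    · simp only [Sum.elim_inl, Sum.elim_inr] at hjj'; exact absurd (hjj' ▸ hg₁ j') (hg₀ j)
    · simp only [Sum.elim_inl, Sum.elim_inr] at hjj'; exact absurd (hjj' ▸ hg₁ j) (hg₀ j')
    · simp only [Sum.elim_inr] at hjj'; rw [g₁.injective hjj']
  -- the cut constants: coordinate `x` reads the state `x` only
  let β : Fin 1 → ℂ := fun _ => 0
  let γ : Fin 1 → Fin h → ℂ := fun _ q => if q = x then 1 else 0
  have hxi : ∀ k, xi (fun k => ((0 : Fin 1), cols k)) β γ k = if x ∈ cols k then 1 else 0 := by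
    intro k
    simp only [xi, β, γ, zero_add]
    rw [Finset.sum_ite_eq' (cols k) x]
  refine symGood_of_split_enum u (fun k => ((0 : Fin 1), cols k)) x β γ hr
    (fun j => f₀ j) (fun j => f₁ j) (fun j => g₀ j) (fun j => g₁ j) hf hg hf₀ hf₁
    (fun j => by rw [hxi, if_neg (hg₀ j)]) (fun j => by rw [hxi, if_pos (hg₁ j)]; exact one_ne_zero) ?_ ?_
  · -- the deletion block
    refine Hdel (fun j => u (f₀ j)) (fun j => cols (g₀ j)) (fun j j' hjj' => f₀.injective (hu hjj'))
      (fun j j' hjj' => g₀.injective (hcinj hjj')) ?_ ?_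
    · intro U
      rw [← hmem𝒰', ← hrow_avoid]
      constructor
      · rintro ⟨j, rfl⟩; exact ⟨f₀ j, rfl, hf₀ j⟩
      · rintro ⟨i, rfl, hxi'⟩
        obtain ⟨j, hj⟩ := hf₀sur i hxi'
        exact ⟨j, by rw [hj]⟩
    · intro J
      rw [← hmemB', ← hcol_avoid]
      constructor
      · rintro ⟨j, rfl⟩; exact ⟨g₀ j, rfl, hg₀ j⟩
      · rintro ⟨k, rfl, hxk⟩
        obtain ⟨j, hj⟩ := hg₀sur k hxk
        exact ⟨j, by rw [hj]⟩
  · -- the link block: erase the state `x` from the columns, then the link family one level down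
    refine symGood_insert_state x (fun j => (u (f₁ j)).erase x) (fun j => cols (g₁ j)) hg₁ ?_
    refine Hlink (fun j => (u (f₁ j)).erase x) (fun j => (cols (g₁ j)).erase x) ?_ ?_ ?_ ?_
    · intro j j' hjj'
      have h1 : u (f₁ j) = u (f₁ j') := by
        rw [← Finset.insert_erase (hf₁ j), ← Finset.insert_erase (hf₁ j')]
        exact congrArg _ hjj'
      exact f₁.injective (hu h1)
    · intro j j' hjj'
      have h1 : cols (g₁ j) = cols (g₁ j') := by
        rw [← Finset.insert_erase (hg₁ j), ← Finset.insert_erase (hg₁ j')]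
        exact congrArg _ hjj'
      exact g₁.injective (hcinj h1)
    · -- rows through `x`, erased = the link family
      intro U
      constructor
      · rintro ⟨j, rfl⟩
        rcases (hU (u (f₁ j))).1 ⟨f₁ j, rfl⟩ with ⟨h1, h2, h3⟩ | ⟨l, hl⟩
        · refine Or.inl ⟨fun a ha => ?_, ?_, fun l hxl hUl => h3 l ?_⟩
          · exact Finset.mem_erase.2 ⟨Finset.ne_of_mem_erase ha, h1 (Finset.mem_of_mem_erase ha)⟩
          · have := Finset.card_erase_of_mem (hf₁ j); omega
          · rw [← Finset.insert_erase (hf₁ j), hUl, Finset.insert_erase hxl]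
        · exact Or.inr ⟨l, hl ▸ hf₁ j, by rw [hl]⟩
      · rintro (⟨h1, h2, h3⟩ | ⟨l, hxl, rfl⟩)
        · have hxU : x ∉ U := fun hx => Finset.notMem_erase x S (h1 hx)
          have hsub : insert x U ⊆ S := by
            intro a ha
            rcases Finset.mem_insert.1 ha with rfl | ha
            · exact hxS
            · exact Finset.mem_of_mem_erase (h1 ha)
          have hcard : (insert x U).card ≤ t + 1 := by rw [Finset.card_insert_of_notMem hxU]; omega
          have hneA : ∀ l, insert x U ≠ A l := by
            intro l hUl
            by_cases hxl : x ∈ A l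
            · exact h3 l hxl (by rw [← hUl, Finset.erase_insert hxU])
            · exact hxl (hUl ▸ Finset.mem_insert_self x U)
          obtain ⟨i, hi⟩ := (hU (insert x U)).2 (Or.inl ⟨hsub, hcard, hneA⟩)
          obtain ⟨j, hj⟩ := hf₁sur i (by simp [hi])
          exact ⟨j, by simp [hj, hi, Finset.erase_insert hxU]⟩
        · obtain ⟨i, hi⟩ := (hU (C l)).2 (Or.inr ⟨l, rfl⟩)
          obtain ⟨j, hj⟩ := hf₁sur i (by rw [hi]; exact hxl)
          exact ⟨j, by rw [hj, hi]⟩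
    · -- columns through `x`, erased = the ball one level down
      intro J
      constructor
      · rintro ⟨j, rfl⟩
        obtain ⟨h1, h2⟩ := (hJ (cols (g₁ j))).1 ⟨g₁ j, rfl⟩
        refine ⟨fun a ha => ?_, ?_⟩
        · exact Finset.mem_erase.2 ⟨Finset.ne_of_mem_erase ha, h1 (Finset.mem_of_mem_erase ha)⟩
        · have := Finset.card_erase_of_mem (hg₁ j); omega
      · rintro ⟨h1, h2⟩
        have hxJ : x ∉ J := fun hx => Finset.notMem_erase x S (h1 hx)
        have hsub : insert x J ⊆ S := by
          intro a ha
          rcases Finset.mem_insert.1 ha with rfl | ha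
          · exact hxS
          · exact Finset.mem_of_mem_erase (h1 ha)
        have hcard : (insert x J).card ≤ t + 1 := by rw [Finset.card_insert_of_notMem hxJ]; omega
        obtain ⟨k, hk⟩ := (hJ (insert x J)).2 ⟨hsub, hcard⟩
        obtain ⟨j, hj⟩ := hg₁sur k (by simp [hk])
        exact ⟨j, by simp [hj, hk, Finset.erase_insert hxJ]⟩

end BallCut

end

end Summit.ValiantsHypothesis.ValiantsHypothesis.Theorems.BarrierLever.HiddenStates
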